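import Summits.QuantumFields.YangMills.Theorems.BalabanUVNodesN08HaarCompatibilityGuardJacobianDet

/-!
# BalabanUVNodes ∕ N08 — THE DETERMINANT FORM ON `𝔰𝔲(N)`: `(1 − Σcᵢ)^(N² − 1) ≤ |det T|` for the left-trivialised tangent map of the
# printed exp-mean-log fibre map on the special unitary group — the Jacobian floor an `SU(N)`-Haar density constant reads

WIDTH SEAT `pub-ymgap-dag-n08-w6` g4 (R399 (3a) second wave; INTENT-2 of record HOME INBOX l.31837, successor of CLAIM-1 = p616149 ✓
`…GuardJacobianDet`), 2026-08-28.  Track A, DAG node N08 = [Balaban1985UV3] Thm 1 p. 257 (compact) + Thm 2 p. 272; key item K1⁷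
`StabilityBAtRecordR13SepCoPH` (stmt-QuantumFields-20542), `--supports … --as helper`.  COUNT-NEUTRAL.

THE POINT.  Part 1 (p616149) typed the determinant form on `𝔲(N)`: `(1 − Σcᵢ)^(N²) ≤ |det T|` for the left-trivialised tangent map
`T X = K_W* · D K_W (W X)` of `K_W = exp(Σᵢ cᵢ log(hᵢ W*))·W` (pub-balaban's `Kmat`∕`emlD`).  The printed average lives on `SU(N)` (the typed
guard `ExpMeanLog.deltaSU = min(1∕3, π∕N)` of `expMeanLogSU`), and a density constant relative to Haar measure OF `SU(N)` reads the Jacobian of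
`K : SU(N) → SU(N)`, i.e. `det` of `T` restricted to the traceless skew-Hermitian matrices `𝔰𝔲(N)` (pub-balaban's `lieSU`, dimension `N² − 1`;
at `N = 2` the `3` of sibling n08-w3's σ-chart engine frame `…GuardChartTransfer`).  THIS FILE:
* §1 `lieSU` facts: `‖X‖² = hs X X` (`norm_sq_eq_hs_lieSU`, definitional through the pinned instance), `lieSU = 𝔲(N) ⊓ ker tr` as the tree's
  carrier (`lieSU_eq_skewAdjoint_inf_ker_trace`), `dim_ℝ 𝔰𝔲(N) = N² − 1` (`finrank_lieSU`, the tree's `QuantumLattice.finrank_skewAdjoint_inf_ker_trace`),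
  and part 1 §1 in `hs`-form on `𝔰𝔲(N)` (`pow_card_sq_sub_one_le_abs_det_of_hs_le`).
* §2 ★ `kmat_mem_specialUnitaryGroup`: `K` maps the `deltaSU`-guarded special unitaries INTO `SU(N)` — every `tr log(hᵢ M*)` vanishes by
  pub-balaban's `ExpMeanLog.trace_mlog_eq_zero` (this is exactly what the `π∕N` in `deltaSU` buys; on the bare guard `‖· − 1‖ < 1∕2` it FAILS for
  large `N`, ibid.), so `det K_M = exp(Σ cᵢ tr log(hᵢM*))·det M = 1` (the tree's Liouville formula `det_exp_eq_exp_trace`);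
  ★★ `trace_star_kmat_mul_emlD_eq_zero`: TRACELESSNESS of `K_W* · D K_W (W X)` for `X ∈ 𝔰𝔲(N)` — `u(t) := K_W* · K(W e^{tX})` lies in `SU(N)` and
  tends to `1`, so `tr log u(t) = 0` for small `t`; differentiating at `t = 0` with `D log(1) = id` (part 14's `fderiv_mlog_one_apply`, pub-balaban's
  `analyticAt_mlog`) and `u′(0) = K_W* · D K_W(W X)` (part 1's `hasDerivAt_kmat_mul_exp_smul`) gives `tr(K_W* · D K_W(W X)) = 0`; with part 1's
  tangency, `star_kmat_mul_emlD_mem_lieSU`.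
* §3 ★ `exists_leftTangent_lieSU` (non-vacuity, A6); ★★★ **`pow_card_sq_sub_one_le_abs_det_leftTangentSU`**: for `W, hᵢ ∈ SU(N)` in the `deltaSU`
  guard, `cᵢ ≥ 0`, `Σcᵢ ≤ 1`, and EVERY `T : 𝔰𝔲(N) →ₗ[ℝ] 𝔰𝔲(N)` with `T X = K_W* · D K_W (W X)`: `(1 − Σcᵢ)^(N² − 1) ≤ |LinearMap.det T|`
  (part 3b's `emlD_tangent_lower_bound_sharp` + §1); ★ `det_leftTangentSU_flat`: `= (1 − Σcᵢ)^(N² − 1)` at the flat background — sharp;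
  ★★ `…_specialUnitary`: the same with `h : ι → SU(N)`, `W : SU(N)` as group elements (the letters of `expMeanLogSU`).

HONEST FRAMING.  Count-neutral helper: [folklore] linear algebra ∕ matrix calculus about the printed (0.4)∕(1.4) fibre map over pub-balaban's
`Kmat`∕`emlD`∕`lieSU`∕`ExpMeanLog` and Mathlib BY IMPORT; NO quantitative `T4HaarSUNLocalDiffeo` engine, NO density bound, NO sheet count is typed here;
nothing of Bałaban's is asserted; E6′ NOT decided; `hmass` NOT supplied; N08 NOT discharged; counts unmoved (typed 28∕28 · discharged 5∕27); no summit
statement is proved by this seat — one finite 𝕋⁴ programme at fixed ε, R4 closes the CONDITIONAL rung `BalabanLadder.UV` only; the Yang–Mills mass gap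
(Clay) is NOT proved by any of this; nothing continuum ∕ ℝ⁴ ∕ OS ∕ mass gap.  0 `sorry`, 0 `def`, 0 `instance`, 0 `notation`, standard axioms.
-/

noncomputable section

open NormedSpace Finset
open scoped Matrix ComplexConjugate

namespace Summit.QuantumFields.YangMills.BalabanUVNodes.N08HaarCompatibilityGuardJacobianDetSU

open Literature.MathematicalPhysics.QuantumFieldTheory.Balaban1983to89
open Literature.MathematicalPhysics.QuantumFieldTheory.Balaban1983to89.T4EMLTangentInjective
open Literature.MathematicalPhysics.QuantumFieldTheory.Balaban1983to89.T4AdjointCovarianceUnitary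
  (lieU lieSU mem_lieU_iff mem_lieSU_iff exp_mem_unitaryGroup_of_mem_lieU exp_mem_specialUnitaryGroup_of_mem_lieSU)
open Summit.QuantumFields.YangMills.BalabanUVNodes.N08HaarCompatibilityGuardJacobian
open Summit.QuantumFields.YangMills.BalabanUVNodes.N08HaarCompatibilityGuardJacobianSharpNorm
open Summit.QuantumFields.YangMills.BalabanUVNodes.N08HaarCompatibilityGuardJacobianDet
open Matrix (unitaryGroup specialUnitaryGroup)
open Literature.MathematicalPhysics.QuantumFieldTheory.Balaban1983to89.MatrixLog (mlog)

/-! ## §1 The Lie algebra `𝔰𝔲(N)` (pub-balaban's `lieSU`, pinned Hilbert–Schmidt norm): `‖X‖² = hs X X`, `dim = N² − 1`, §1 of part 1 in `hs`-form -/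

section LieSU

open Module

variable {m : Type*} [Fintype m] [DecidableEq m]

omit [DecidableEq m] in
/-- On `𝔰𝔲(N)` with its pinned Hilbert–Schmidt inner product, `‖X‖² = hs X X` — definitionally. [folklore] -/
theorem norm_sq_eq_hs_lieSU (X : lieSU m) : ‖X‖ ^ 2 = hs (X : Matrix m m ℂ) (X : Matrix m m ℂ) := by
  rw [← real_inner_self_eq_norm_sq]
  rfl

omit [DecidableEq m] in
/-- pub-balaban's `lieSU` IS the tree's `𝔲(N) ∩ ker tr` of `QuantumLattice.RepLieAlgebraUnitary` (same carrier). [folklore] -/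
theorem lieSU_eq_skewAdjoint_inf_ker_trace :
    lieSU m = skewAdjoint.submodule ℝ (Matrix m m ℂ) ⊓ LinearMap.ker (Matrix.traceLinearMap m ℝ ℂ) := by
  ext X
  rw [mem_lieSU_iff, Submodule.mem_inf, LinearMap.mem_ker, Matrix.traceLinearMap_apply]
  exact Iff.rfl

/-- `dim_ℝ 𝔰𝔲(N) = N² − 1` for pub-balaban's `lieSU` (`QuantumLattice.finrank_skewAdjoint_inf_ker_trace`). [folklore] -/
theorem finrank_lieSU : finrank ℝ (lieSU m) = Fintype.card m ^ 2 - 1 := by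
  rw [lieSU_eq_skewAdjoint_inf_ker_trace]
  exact Literature.MathematicalPhysics.QuantumLattice.finrank_skewAdjoint_inf_ker_trace

/-- **Part 1 §1 in Hilbert–Schmidt form on `𝔰𝔲(N)`**: an `ℝ`-linear endomorphism `T` of `𝔰𝔲(N)` with `λ²·hs(X,X) ≤ hs(TX,TX)` (`λ ≥ 0`)
has `λ^(N² − 1) ≤ |det T|`. [folklore] -/
theorem pow_card_sq_sub_one_le_abs_det_of_hs_le (T : lieSU m →ₗ[ℝ] lieSU m) {l : ℝ} (hl : 0 ≤ l)
    (hT : ∀ X : lieSU m, l ^ 2 * hs (X : Matrix m m ℂ) (X : Matrix m m ℂ)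
      ≤ hs ((T X : lieSU m) : Matrix m m ℂ) ((T X : lieSU m) : Matrix m m ℂ)) :
    l ^ (Fintype.card m ^ 2 - 1) ≤ |LinearMap.det T| := by
  rw [← finrank_lieSU]
  refine pow_finrank_le_abs_det_of_mul_norm_le T hl fun X => ?_
  have h1 : (l * ‖X‖) ^ 2 ≤ ‖T X‖ ^ 2 := by
    rw [mul_pow, norm_sq_eq_hs_lieSU, norm_sq_eq_hs_lieSU]; exact hT X
  exact (pow_le_pow_iff_left₀ (mul_nonneg hl (norm_nonneg _)) (norm_nonneg _) two_ne_zero).1 h1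

end LieSU

/-! ## §2 `K` maps the `deltaSU`-guarded special unitaries into `SU(N)`; the left-trivialised derivative is TRACELESS on `𝔰𝔲(N)` -/

section TangencySU

open scoped Matrix.Norms.L2Operator
open Filter Topology

variable {m : Type*} [Fintype m] [DecidableEq m] [Nonempty m] {ι : Type*} [Fintype ι]

omit [Nonempty m] [Fintype ι] in
/-- On the `deltaSU` guard the guard of parts 1–3 holds: `deltaSU ≤ 1∕3 < 1∕2`. [folklore] -/
theorem guard_half_of_deltaSU {h : ι → Matrix m m ℂ} {M : Matrix m m ℂ} (hg : ∀ i, ‖h i * star M - 1‖ < ExpMeanLog.deltaSU m) (i : ι) :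
    ‖h i * star M - 1‖ < 1 / 2 := by
  have := ExpMeanLog.lt_third_of_lt_deltaSU (hg i); linarith

omit [Nonempty m] [Fintype ι] in
/-- `SU(N)` is closed under `star` (= inverse): `(M*)* M* = 1` and `det M* = conj(det M) = 1`. [folklore] -/
theorem star_mem_specialUnitaryGroup {M : Matrix m m ℂ} (hM : M ∈ specialUnitaryGroup m ℂ) :
    star M ∈ specialUnitaryGroup m ℂ := by
  rw [Matrix.mem_specialUnitaryGroup_iff] at hM ⊢
  refine ⟨Unitary.star_mem hM.1, ?_⟩
  rw [Matrix.star_eq_conjTranspose, Matrix.det_conjTranspose, hM.2, star_one]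

/-- **`K` maps the `deltaSU`-guarded special unitaries into `SU(N)`**: for `M, hᵢ ∈ SU(N)` with `‖hᵢ M* − 1‖ < deltaSU = min(1∕3, π∕N)`,
every `tr log(hᵢ M*)` vanishes (pub-balaban's `ExpMeanLog.trace_mlog_eq_zero` — this is what the `π∕N` in `deltaSU` is for), so
`det exp(Σ cᵢ log(hᵢ M*)) = exp(Σ cᵢ tr log(hᵢ M*)) = 1` (Liouville, the tree's `det_exp_eq_exp_trace`). [folklore] -/
theorem kmat_mem_specialUnitaryGroup {h : ι → Matrix m m ℂ} (hh : ∀ i, h i ∈ specialUnitaryGroup m ℂ) {M : Matrix m m ℂ}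
    (hM : M ∈ specialUnitaryGroup m ℂ) (hg : ∀ i, ‖h i * star M - 1‖ < ExpMeanLog.deltaSU m) (c : ι → ℝ) :
    Kmat h c M ∈ specialUnitaryGroup m ℂ := by
  have hhu : ∀ i, h i ∈ unitaryGroup m ℂ := fun i => (Matrix.mem_specialUnitaryGroup_iff.mp (hh i)).1
  have hMu : M ∈ unitaryGroup m ℂ := (Matrix.mem_specialUnitaryGroup_iff.mp hM).1
  rw [Matrix.mem_specialUnitaryGroup_iff]
  refine ⟨kmat_mem_unitaryGroup hhu hMu (guard_half_of_deltaSU hg) c, ?_⟩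
  have hP : ∀ i, h i * star M ∈ specialUnitaryGroup m ℂ := fun i =>
    mul_mem (hh i) (star_mem_specialUnitaryGroup hM)
  have htr : ∀ i, (mlog (h i * star M)).trace = 0 := fun i =>
    ExpMeanLog.trace_mlog_eq_zero (hP i) (ExpMeanLog.lt_third_of_lt_deltaSU (hg i)).le (ExpMeanLog.mul_lt_pi_of_lt_deltaSU (hg i))
  show (exp (∑ i, (c i : ℂ) • mlog (h i * star M)) * M).det = 1
  rw [Matrix.det_mul, (Matrix.mem_specialUnitaryGroup_iff.mp hM).2, mul_one, Literature.Analysis.Matrix.det_exp_eq_exp_trace,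
    Matrix.trace_sum]
  simp only [Matrix.trace_smul, htr, smul_zero, Finset.sum_const_zero, exp_zero]

omit [Nonempty m] in
/-- The curve `t ↦ W·exp(tX)` stays in `SU(N)` for `W ∈ SU(N)` and `X ∈ 𝔰𝔲(N)`. [folklore] -/
theorem mul_exp_smul_mem_specialUnitaryGroup {W : Matrix m m ℂ} (hW : W ∈ specialUnitaryGroup m ℂ) {X : Matrix m m ℂ}
    (hX : X ∈ lieSU m) (t : ℝ) : W * exp (t • X) ∈ specialUnitaryGroup m ℂ :=
  mul_mem hW (exp_mem_specialUnitaryGroup_of_mem_lieSU ((lieSU m).smul_mem t hX))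

/-- ★ **TRACELESSNESS.**  For `W, hᵢ ∈ SU(N)` in the `deltaSU` guard and `X ∈ 𝔰𝔲(N)`, the left-trivialised derivative
`K_W* · D K_W (W X)` is traceless.  PROOF: `u(t) := K_W* · K(W e^{tX})` lies in `SU(N)` and tends to `1`, so for small `t`
`tr log u(t) = 0` (`trace_mlog_eq_zero`); differentiating `t ↦ tr log u(t)` at `0` (`D log(1) = id`, part 14's
`fderiv_mlog_one_apply`) gives `tr u′(0) = tr(K_W* · D K_W(W X)) = 0`. [folklore] -/
theorem trace_star_kmat_mul_emlD_eq_zero {h : ι → Matrix m m ℂ} (hh : ∀ i, h i ∈ specialUnitaryGroup m ℂ) {W : Matrix m m ℂ}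
    (hW : W ∈ specialUnitaryGroup m ℂ) (hg : ∀ i, ‖h i * star W - 1‖ < ExpMeanLog.deltaSU m) (c : ι → ℝ) {X : Matrix m m ℂ}
    (hX : X ∈ lieSU m) : (star (Kmat h c W) * emlD h c W (W * X)).trace = 0 := by
  set γ : ℝ → Matrix m m ℂ := fun t => W * exp (t • X) with hγ
  set u : ℝ → Matrix m m ℂ := fun t => star (Kmat h c W) * Kmat h c (γ t) with hudef
  set E : Matrix m m ℂ := emlD h c W (W * X)
  have hW1 : ∀ i, ‖h i * star W - 1‖ < 1 := fun i => (guard_half_of_deltaSU hg i).trans (by norm_num)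
  have hKsu : Kmat h c W ∈ specialUnitaryGroup m ℂ := kmat_mem_specialUnitaryGroup hh hW hg c
  have hKu : star (Kmat h c W) * Kmat h c W = 1 :=
    Matrix.mem_unitaryGroup_iff'.mp (Matrix.mem_specialUnitaryGroup_iff.mp hKsu).1
  have hud : HasDerivAt u (star (Kmat h c W) * E) 0 := (hasDerivAt_kmat_mul_exp_smul hW1 c X).const_mul _
  have hγ0 : γ 0 = W := by simp [hγ]
  have hu0 : u 0 = 1 := by simp [hudef, hγ0, hKu]
  -- `u t → 1`
  have huc : Tendsto u (𝓝 0) (𝓝 1) := by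
    have := hud.continuousAt.tendsto
    rwa [hu0] at this
  have hγd : HasDerivAt γ (W * X) 0 := hasDerivAt_mul_exp_smul W X
  have hγc : Tendsto γ (𝓝 0) (𝓝 W) := by
    have := hγd.continuousAt.tendsto
    rwa [hγ0] at this
  -- eventually: the guard holds along the curve and `‖u t − 1‖ < deltaSU`
  have hev : ∀ᶠ t in 𝓝 (0 : ℝ), (∀ i, ‖h i * star (γ t) - 1‖ < ExpMeanLog.deltaSU m) ∧ ‖u t - 1‖ < ExpMeanLog.deltaSU m := by
    refine (eventually_all.2 fun i => ?_).and ?_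
    · have hF : Continuous fun M : Matrix m m ℂ => ‖h i * star M - 1‖ :=
        ((continuous_const.mul continuous_star).sub continuous_const).norm
      exact ((hF.tendsto W).comp hγc).eventually_lt_const (hg i)
    · have hF : Continuous fun M : Matrix m m ℂ => ‖M - 1‖ := (continuous_id.sub continuous_const).norm
      have h0 : ‖(1 : Matrix m m ℂ) - 1‖ < ExpMeanLog.deltaSU m := by rw [sub_self, norm_zero]; exact ExpMeanLog.deltaSU_pos
      exact ((hF.tendsto 1).comp huc).eventually_lt_const h0
  -- so `tr log u(t) = 0` eventually
  have hev0 : (fun t => (mlog (u t)).trace) =ᶠ[𝓝 (0 : ℝ)] fun _ => (0 : ℂ) := by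
    filter_upwards [hev] with t ht
    have hut : u t ∈ specialUnitaryGroup m ℂ :=
      mul_mem (star_mem_specialUnitaryGroup hKsu)
        (kmat_mem_specialUnitaryGroup hh (mul_exp_smul_mem_specialUnitaryGroup hW hX t) ht.1 c)
    exact ExpMeanLog.trace_mlog_eq_zero hut (ExpMeanLog.lt_third_of_lt_deltaSU ht.2).le
      (ExpMeanLog.mul_lt_pi_of_lt_deltaSU ht.2)
  -- differentiate `t ↦ tr log u(t)` at `0`
  have hlog : HasFDerivAt (𝕜 := ℝ) mlog ((fderiv ℂ mlog (1 : Matrix m m ℂ)).restrictScalars ℝ) (1 : Matrix m m ℂ) :=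
    ((MatrixLog.analyticAt_mlog (by rw [sub_self, norm_zero]; exact one_pos)).differentiableAt.hasFDerivAt).restrictScalars ℝ
  have hv : HasDerivAt (fun t => mlog (u t)) (star (Kmat h c W) * E) 0 := by
    have := hlog.comp_hasDerivAt_of_eq (0 : ℝ) hud hu0.symm
    rwa [ContinuousLinearMap.coe_restrictScalars', fderiv_mlog_one_apply] at this
  let τ : Matrix m m ℂ →L[ℝ] ℂ := LinearMap.toContinuousLinearMap ((Matrix.traceLinearMap m ℂ ℂ).restrictScalars ℝ)
  have hτ : ∀ M : Matrix m m ℂ, τ M = M.trace := fun M => rfl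
  have hw : HasDerivAt (fun t => (mlog (u t)).trace) (star (Kmat h c W) * E).trace 0 := by
    have := τ.hasFDerivAt.comp_hasDerivAt (0 : ℝ) hv
    simpa only [Function.comp_def, hτ] using this
  have hconst : HasDerivAt (fun t => (mlog (u t)).trace) (0 : ℂ) 0 :=
    (hasDerivAt_const (0 : ℝ) (0 : ℂ)).congr_of_eventuallyEq hev0
  exact hw.unique hconst

/-- The left-trivialised derivative maps `𝔰𝔲(N)` into `𝔰𝔲(N)` (skew by part-1 tangency, traceless by the above). [folklore] -/
theorem star_kmat_mul_emlD_mem_lieSU {h : ι → Matrix m m ℂ} (hh : ∀ i, h i ∈ specialUnitaryGroup m ℂ) {W : Matrix m m ℂ}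
    (hW : W ∈ specialUnitaryGroup m ℂ) (hg : ∀ i, ‖h i * star W - 1‖ < ExpMeanLog.deltaSU m) (c : ι → ℝ) {X : Matrix m m ℂ}
    (hX : X ∈ lieSU m) : star (Kmat h c W) * emlD h c W (W * X) ∈ lieSU m := by
  have hXu : X ∈ lieU m := (Submodule.mem_inf.mp hX).1
  have h1 := star_kmat_mul_emlD_mem_lieU (fun i => (Matrix.mem_specialUnitaryGroup_iff.mp (hh i)).1)
    (Matrix.mem_specialUnitaryGroup_iff.mp hW).1 (guard_half_of_deltaSU hg) c hXu
  rw [mem_lieSU_iff]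
  exact ⟨mem_lieU_iff.1 h1, trace_star_kmat_mul_emlD_eq_zero hh hW hg c hX⟩

end TangencySU

/-! ## §3 THE DETERMINANT FORM ON `𝔰𝔲(N)` -/

section DeterminantSU

open scoped Matrix.Norms.L2Operator
open Module

variable {m : Type*} [Fintype m] [DecidableEq m] [Nonempty m] {ι : Type*} [Fintype ι]

/-- ★ **THE LEFT-TRIVIALISED TANGENT MAP EXISTS AS AN ENDOMORPHISM OF `𝔰𝔲(N)`** on the `deltaSU` guard (non-vacuity — A6). [folklore] -/
theorem exists_leftTangent_lieSU {h : ι → Matrix m m ℂ} (hh : ∀ i, h i ∈ specialUnitaryGroup m ℂ) {W : Matrix m m ℂ}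
    (hW : W ∈ specialUnitaryGroup m ℂ) (hg : ∀ i, ‖h i * star W - 1‖ < ExpMeanLog.deltaSU m) (c : ι → ℝ) :
    ∃ T : lieSU m →ₗ[ℝ] lieSU m, ∀ X : lieSU m,
      ((T X : lieSU m) : Matrix m m ℂ) = star (Kmat h c W) * emlD h c W (W * (X : Matrix m m ℂ)) := by
  let F : Matrix m m ℂ →ₗ[ℝ] Matrix m m ℂ :=
    (LinearMap.mulLeft ℝ (star (Kmat h c W))) ∘ₗ (emlD h c W).toLinearMap ∘ₗ (LinearMap.mulLeft ℝ W)
  have hF : ∀ X : Matrix m m ℂ, F X = star (Kmat h c W) * emlD h c W (W * X) := fun X => rfl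
  refine ⟨F.restrict (p := lieSU m) (q := lieSU m) fun X hX => ?_, fun X => rfl⟩
  rw [hF]
  exact star_kmat_mul_emlD_mem_lieSU hh hW hg c hX

/-- ★★★ **THE DETERMINANT FORM OF THE SHARP JACOBIAN BOUND ON `SU(N)`.**  For `W, hᵢ ∈ SU(N)` in the typed guard
`‖hᵢW* − 1‖ < deltaSU = min(1∕3, π∕N)` of the printed average, weights `cᵢ ≥ 0` with `Σcᵢ ≤ 1`, and ANY `ℝ`-linear endomorphism `T`
of `𝔰𝔲(N)` agreeing with the left-trivialised tangent map `T X = K_W* · D K_W (W X)` (one exists: `exists_leftTangent_lieSU`):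
  `(1 − Σcᵢ)^(N² − 1) ≤ |det T|`
— the per-bond Jacobian floor relative to Haar measure of `SU(N)` that a fibre-law density constant reads (`(1 − Σcᵢ) = L^{1−d}` at the
[B10] slot), sharp (`det_leftTangentSU_flat`). [folklore] -/
theorem pow_card_sq_sub_one_le_abs_det_leftTangentSU {h : ι → Matrix m m ℂ} (hh : ∀ i, h i ∈ specialUnitaryGroup m ℂ)
    {W : Matrix m m ℂ} (hW : W ∈ specialUnitaryGroup m ℂ) (hg : ∀ i, ‖h i * star W - 1‖ < ExpMeanLog.deltaSU m)
    {c : ι → ℝ} (hc0 : ∀ i, 0 ≤ c i) (hc1 : ∑ i, c i ≤ 1) (T : lieSU m →ₗ[ℝ] lieSU m)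
    (hT : ∀ X : lieSU m, ((T X : lieSU m) : Matrix m m ℂ) = star (Kmat h c W) * emlD h c W (W * (X : Matrix m m ℂ))) :
    (1 - ∑ i, c i) ^ (Fintype.card m ^ 2 - 1) ≤ |LinearMap.det T| := by
  have hhu : ∀ i, h i ∈ unitaryGroup m ℂ := fun i => (Matrix.mem_specialUnitaryGroup_iff.mp (hh i)).1
  have hWu : W ∈ unitaryGroup m ℂ := (Matrix.mem_specialUnitaryGroup_iff.mp hW).1
  have hg' : ∀ i, ‖h i * star W - 1‖ < 1 / 2 := guard_half_of_deltaSU hg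
  have hKu' : star (star (Kmat h c W)) * star (Kmat h c W) = 1 := by
    rw [star_star]; exact Matrix.mem_unitaryGroup_iff.mp (kmat_mem_unitaryGroup hhu hWu hg' c)
  refine pow_card_sq_sub_one_le_abs_det_of_hs_le T (by linarith) fun X => ?_
  have hX : ((X : lieSU m) : Matrix m m ℂ)ᴴ = -(X : Matrix m m ℂ) := by
    rw [← Matrix.star_eq_conjTranspose]; exact (mem_lieSU_iff.1 X.2).1
  rw [hT X, hs_unitary_mul hKu']
  exact emlD_tangent_lower_bound_sharp hhu hWu hg' hc0 hc1 (X : Matrix m m ℂ) hX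

/-- ★ **SHARPNESS AT THE FLAT BACKGROUND** on `𝔰𝔲(N)`: if every `hᵢ = W` then `T = (1 − Σcᵢ)·id` and `det T = (1 − Σcᵢ)^(N² − 1)`. [folklore] -/
theorem det_leftTangentSU_flat {W : Matrix m m ℂ} (hW : W ∈ specialUnitaryGroup m ℂ) (c : ι → ℝ) (T : lieSU m →ₗ[ℝ] lieSU m)
    (hT : ∀ X : lieSU m, ((T X : lieSU m) : Matrix m m ℂ)
      = star (Kmat (fun _ : ι => W) c W) * emlD (fun _ : ι => W) c W (W * (X : Matrix m m ℂ))) :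
    LinearMap.det T = (1 - ∑ i, c i) ^ (Fintype.card m ^ 2 - 1) := by
  have hWu : W ∈ unitaryGroup m ℂ := (Matrix.mem_specialUnitaryGroup_iff.mp hW).1
  have hW1 : star W * W = 1 := Matrix.mem_unitaryGroup_iff'.mp hWu
  have hW2 : W * star W = 1 := Matrix.mem_unitaryGroup_iff.mp hWu
  have hK : Kmat (fun _ : ι => W) c W = W := by
    show exp (∑ i, (c i : ℂ) • mlog (W * star W)) * W = W
    rw [hW2, MatrixLog.mlog_one]; simp
  rw [← finrank_lieSU]
  refine det_eq_pow_finrank_of_eq_smul T fun X => Subtype.ext ?_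
  have hX : ((X : lieSU m) : Matrix m m ℂ)ᴴ = -(X : Matrix m m ℂ) := by
    rw [← Matrix.star_eq_conjTranspose]; exact (mem_lieSU_iff.1 X.2).1
  rw [hT X, hK, emlD_flat hWu c _ hX, Matrix.mul_smul, ← Matrix.mul_assoc, hW1, Matrix.one_mul, Submodule.coe_smul,
    Complex.coe_smul]

/-- ★★ **TYPED-GUARD READING** with `h : ι → SU(N)`, `W : SU(N)` as group elements (the letters of `ExpMeanLog.expMeanLogSU` and of part 3b's
`emlD_tangent_lower_bound_sharp_specialUnitary`): `(1 − Σcᵢ)^(N² − 1) ≤ |det T|`, one `W`-uniform floor on the whole guard, every `N`. [folklore] -/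
theorem pow_card_sq_sub_one_le_abs_det_leftTangentSU_specialUnitary {n : Type} [DecidableEq n] [Fintype n] [Nonempty n]
    (h : ι → Matrix.specialUnitaryGroup n ℂ) (W : Matrix.specialUnitaryGroup n ℂ)
    (hg : ∀ i, ‖(h i : Matrix n n ℂ) * star (W : Matrix n n ℂ) - 1‖ < ExpMeanLog.deltaSU n)
    {c : ι → ℝ} (hc0 : ∀ i, 0 ≤ c i) (hc1 : ∑ i, c i ≤ 1) (T : lieSU n →ₗ[ℝ] lieSU n)
    (hT : ∀ X : lieSU n, ((T X : lieSU n) : Matrix n n ℂ)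
      = star (Kmat (fun i => (h i : Matrix n n ℂ)) c W) * emlD (fun i => (h i : Matrix n n ℂ)) c W (W * (X : Matrix n n ℂ))) :
    (1 - ∑ i, c i) ^ (Fintype.card n ^ 2 - 1) ≤ |LinearMap.det T| :=
  pow_card_sq_sub_one_le_abs_det_leftTangentSU (fun i => (h i).2) W.2 hg hc0 hc1 T hT

end DeterminantSU

end Summit.QuantumFields.YangMills.BalabanUVNodes.N08HaarCompatibilityGuardJacobianDetSU

end
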